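import Summits.HodgeConjecture.HodgeConjecture.Theorems.F0P3cStCharTSHtauOnCoset    -- ★ p849908 LH6-p03 (g2) HTAU-ON-COSET: carriers, `finTau` at the representatives `τ u := finTau L v (↑u.1, u.2) μ`
import HarnessLib

/-!
# F0 · P3c · line LH6 «StCharTS» — road (D) «DEEP-FL», brick «CJ-BLOCK»: the head's coefficient block — ONE family `c_u := τ_u · (κ_G κ) ∕ κ_{H,u}` on the refined
# representatives `u ∈ F` serving BOTH the TRANSFER `hval` slot (★ p849876 ∕ ★ KIT-B) and the VALUE `hc` slot (★ p850018 ∕ ★ VALUE-ALGEBRA)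

Cell `pub/hodgecm-mathlib`, crux H413 = `stmt-HodgeConjecture-24833` (lane `--supports … --as helper`), route HCCMUnconditional; seat F0P2-p06 (g15), dealt by the road-(D) owner
LH6-p04 (g3) 2026-09-02T07:18:37Z («CJ-BLOCK★»; board `F0/P3b/LH6-p04/g3/ROAD-D.status.v7.txt` 7d68ee6667d2d4d5).  THEOREMS ONLY, sorry-free, ★-only imports; no definition ∕
instance ∕ notation ∕ named fact (the coefficient family is delivered as an `∃ cj, …` together with its closed form, never as a `def`).  HONEST LABEL: count-neutral plumbing of
road (D) — nothing here closes (S-X) `stub_StXIGSt`; HC_CM is proved only modulo the 7 printed citations (2 remaining: hLiu418 = stmt-HodgeConjecture-24832, h413 =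
stmt-HodgeConjecture-24833) until rung 0 closes.

THE MATHEMATICS ([Rogawski1990, §4.9 Lemma 4.9.2, (4.9.4) p. 56; §12.7 Lemma 12.7.3 (proof) p. 195]).  The refined `H`-test function of the XIG-ASSEMBLY head is
`f^H₀ = Σ_{u ∈ F} c_u · 𝟙_{K_H u K_H}` over the representatives `F` of ★ XIG-DATA `exists_xigData` (a finset of `T₂ × U(Φ₁)_v`).  Two checklists consume the coefficients:
the TRANSFER third ★ `F0P3cStCharTSTransferChecklist.isLocalDeltaTransfer_doubleCosetSum_of_checklist` through the slot `hval : ∀ u ∈ F, c_u · κ_{H,u} = τ_u · (κ_G κ)` of ★ KIT-B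
`hc_of_cosetSum` (with `τ_u := finTau L v (↑u.1, u.2) μ`, the value of `τ_v` at the representative — ★ HTAU `exists_level_hτ_of_smul_cosets` supplies `hτ` in exactly this
spelling), and the VALUE third ★ `F0P3cStCharTSValueChecklist.steinbergLabel_smoothTrace_sum_eq_value` through `hc : ∀ u ∈ F, c_u · (A_u r_H) = τ_u · (A_G r_G)` (★ VALUE-ALGEBRA
`sum_coeff_mul_trace_eq_value'`).  Both are met by the ONE choice `c_u := τ_u · (κ_G κ) ∕ κ_{H,u}` as soon as `κ_{H,u} ≠ 0` on `F` (★ CONSTANTS `kappaH_ne_zero`) — the second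
under the head's identification of letters `κ_{H,u} = A_u · r_H`, `κ_G κ = A_G · r_G` (hypotheses BY SHAPE here; they are how the head NAMES the same ★ D3-ii constants in the two
thirds).  §1 generic over any index type; §2 the CM instance on `XH = T₂ × U(Φ₁)_v` with `τ` spelled as ★ HTAU prints it.

## References
* [Rogawski1990] J. D. Rogawski, *Automorphic Representations of Unitary Groups in Three Variables*, Ann. of Math. Stud. 123 (1990): §4.9 Lemma 4.9.2, (4.9.4) p. 56;
  §12.7 Lemma 12.7.3 (proof) p. 195.
-/

set_option autoImplicit false
-- the mandated namespace has the single-problem summit's repeated segment (`HodgeConjecture.HodgeConjecture`)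
set_option linter.dupNamespace false

noncomputable section

open Matrix NumberField IsDedekindDomain
open scoped MatrixGroups Pointwise
open Literature.NumberTheory.Rogawski1990 Literature.NumberTheory.Automorphic Literature.NumberTheory.Automorphic.UnitaryGroup
open Literature.NumberTheory.GaloisRepresentations

namespace Summit.HodgeConjecture.HodgeConjecture.Cruxes.H413.F0P3cStCharTSCjBlock

/-! ## §1 Generic: the coefficient family over any index type -/

section Generic

variable {ι : Type*}

/-- **The coefficient family** `c_j := τ_j · c ∕ κ_{H,j}` on a finset `s` where `κ_{H,j} ≠ 0`: it EXISTS (no `def`), with its closed form and the TRANSFER `hval` identity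
`c_j · κ_{H,j} = τ_j · c` (`c = κ_G κ` in ★ KIT-B `hc_of_cosetSum`, `c = κ_G` in `hc_of_cosetSum'`). [cite: Rogawski1990, §12.7 Lemma 12.7.3 (proof) p. 195] -/
theorem exists_cj (s : Finset ι) (τ κH : ι → ℂ) (c : ℂ) (hκH : ∀ j ∈ s, κH j ≠ 0) :
    ∃ cj : ι → ℂ, (∀ j ∈ s, cj j = τ j * c / κH j) ∧ (∀ j ∈ s, cj j * κH j = τ j * c) :=
  ⟨fun j => τ j * c / κH j, fun _ _ => rfl, fun j hj => div_mul_cancel₀ _ (hκH j hj)⟩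

/-- **From `hval` to the VALUE `hc`** under the identification of letters `κ_{H,j} = A_j · r_H` (per summand) and `c = A_G · r_G`: `c_j · (A_j r_H) = τ_j · (A_G r_G)` — the `hc` slot of
★ `sum_coeff_mul_trace_eq_value'` ∕ ★ `steinbergLabel_smoothTrace_sum_eq_value`. [cite: Rogawski1990, §12.7 Lemma 12.7.3 (proof) p. 195] -/
theorem hc_value_of_hval (s : Finset ι) (cj τ κH A : ι → ℂ) (c AG rG rH : ℂ)
    (hval : ∀ j ∈ s, cj j * κH j = τ j * c) (hAH : ∀ j ∈ s, κH j = A j * rH) (hAG : c = AG * rG) :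
    ∀ j ∈ s, cj j * (A j * rH) = τ j * (AG * rG) := fun j hj => by
  rw [← hAH j hj, ← hAG]; exact hval j hj

/-- **ONE family for BOTH thirds**: on `s`, with `κ_{H,j} ≠ 0`, `κ_{H,j} = A_j · r_H`, `c = A_G · r_G`, there is `cj` with its closed form `c_j = τ_j · c ∕ κ_{H,j}`, the TRANSFER
identity `c_j · κ_{H,j} = τ_j · c` and the VALUE identity `c_j · (A_j r_H) = τ_j · (A_G r_G)`. [cite: Rogawski1990, §4.9 Lemma 4.9.2 p. 56; §12.7 Lemma 12.7.3 (proof) p. 195] -/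
theorem exists_cj_both (s : Finset ι) (τ κH A : ι → ℂ) (c AG rG rH : ℂ) (hκH : ∀ j ∈ s, κH j ≠ 0)
    (hAH : ∀ j ∈ s, κH j = A j * rH) (hAG : c = AG * rG) :
    ∃ cj : ι → ℂ, (∀ j ∈ s, cj j = τ j * c / κH j) ∧ (∀ j ∈ s, cj j * κH j = τ j * c) ∧ (∀ j ∈ s, cj j * (A j * rH) = τ j * (AG * rG)) := by
  obtain ⟨cj, hform, hval⟩ := exists_cj s τ κH c hκH
  exact ⟨cj, hform, hval, hc_value_of_hval s cj τ κH A c AG rG rH hval hAH hAG⟩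

/-- The VALUE identity alone determines nothing new: conversely, from `hc` and the same identifications (with `r_H ≠ 0`, `A_j ≠ 0`) one recovers `hval` — so the two slots are
EQUIVALENT descriptions of the one family (bookkeeping check for the head). [cite: Rogawski1990, §12.7 Lemma 12.7.3 (proof) p. 195] -/
theorem hval_of_hc_value (s : Finset ι) (cj τ κH A : ι → ℂ) (c AG rG rH : ℂ)
    (hc : ∀ j ∈ s, cj j * (A j * rH) = τ j * (AG * rG)) (hAH : ∀ j ∈ s, κH j = A j * rH) (hAG : c = AG * rG) :
    ∀ j ∈ s, cj j * κH j = τ j * c := fun j hj => by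
  rw [hAH j hj, hAG]; exact hc j hj

end Generic

/-! ## §2 The CM instance: representatives in `XH = T₂ × U(Φ₁)_v`, `τ_u := finTau L v (↑u.1, u.2) μ` -/

section CM

variable (L : Type) [Field L] [NumberField L] [IsCMField L] (v : HeightOneSpectrum (𝓞 ↥(maximalRealSubfield L)))

/-- **«CJ-BLOCK» (TRANSFER form).**  For a Hecke character `μ`, a finset `F` of representatives in `T₂ × U(Φ₁)_v` (★ XIG-DATA `exists_xigData`), constants `κ_G, κ : ℂ` (the
`G`-side two-coset constants of OCAN-SHELL ∕ HF1-SHELL, BY SHAPE) and `κ_H : XH → ℂ` non-zero on `F` (HOH-FLIP's per-summand constants, BY SHAPE; non-vanishing = ★ CONSTANTS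
`kappaH_ne_zero`): there is ONE coefficient family `cj` with `cj u = finTau L v (↑u.1, u.2) μ · (κ_G κ) ∕ κ_H u` and the `hval` slot of ★ KIT-B `hc_of_cosetSum` ∕ ★ p849876 for
`τ u := finTau L v (↑u.1, u.2) μ` (the spelling of ★ HTAU `exists_level_hτ_of_smul_cosets` with `u := id`). [cite: Rogawski1990, §4.9 Lemma 4.9.2 p. 56; §12.7 Lemma 12.7.3
(proof) p. 195] -/
theorem exists_cj_finTau (μ : HeckeCharacter L)
    (F : Finset (↥(cmBorelTriple L 2 v).M × (cmDatum L 1 (Matrix.of fun i j : Fin 1 => if i.val + j.val + 1 = 1 then (1 : L) else 0)).Local v))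
    (κG κ : ℂ)
    (κH : ↥(cmBorelTriple L 2 v).M × (cmDatum L 1 (Matrix.of fun i j : Fin 1 => if i.val + j.val + 1 = 1 then (1 : L) else 0)).Local v → ℂ)
    (hκH : ∀ u ∈ F, κH u ≠ 0) :
    ∃ cj : ↥(cmBorelTriple L 2 v).M × (cmDatum L 1 (Matrix.of fun i j : Fin 1 => if i.val + j.val + 1 = 1 then (1 : L) else 0)).Local v → ℂ,
      (∀ u ∈ F, cj u =
        finTau L v ((u.1 : ↥(unitaryGroupOfForm (conjLocal L (IsCMField.complexConj L) v) (cmLocalForm L 2 v))), u.2) μ * (κG * κ) / κH u) ∧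
      (∀ u ∈ F, cj u * κH u =
        finTau L v ((u.1 : ↥(unitaryGroupOfForm (conjLocal L (IsCMField.complexConj L) v) (cmLocalForm L 2 v))), u.2) μ * (κG * κ)) :=
  exists_cj F (fun u => finTau L v ((u.1 : ↥(unitaryGroupOfForm (conjLocal L (IsCMField.complexConj L) v) (cmLocalForm L 2 v))), u.2) μ) κH (κG * κ) hκH

/-- **«CJ-BLOCK» (BOTH thirds).**  As `exists_cj_finTau`, plus the VALUE slot `hc : ∀ u ∈ F, cj u · (A u · r_H) = τ u · (A_G · r_G)` of ★ `steinbergLabel_smoothTrace_sum_eq_value` ∕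
★ `sum_coeff_mul_trace_eq_value'` under the head's identification of letters `κ_H u = A u · r_H` (`u ∈ F`), `κ_G κ = A_G · r_G` (BY SHAPE: the two thirds name the same ★ D3-ii
constants — `A u` = the hF1H-ADAPTER constant, `r_H = μ_T{T₂ ∩ K_{2,v}}·ν₁(univ) ∕ (μ_T(C₂)·ν₁(K₁))`-type, `A_G`, `r_G` likewise on `G`). [cite: Rogawski1990, §4.9 Lemma 4.9.2
p. 56; §12.7 Lemma 12.7.3 (proof) p. 195] -/
theorem exists_cj_finTau_both (μ : HeckeCharacter L)
    (F : Finset (↥(cmBorelTriple L 2 v).M × (cmDatum L 1 (Matrix.of fun i j : Fin 1 => if i.val + j.val + 1 = 1 then (1 : L) else 0)).Local v))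
    (κG κ AG rG rH : ℂ)
    (κH A : ↥(cmBorelTriple L 2 v).M × (cmDatum L 1 (Matrix.of fun i j : Fin 1 => if i.val + j.val + 1 = 1 then (1 : L) else 0)).Local v → ℂ)
    (hκH : ∀ u ∈ F, κH u ≠ 0) (hAH : ∀ u ∈ F, κH u = A u * rH) (hAG : κG * κ = AG * rG) :
    ∃ cj : ↥(cmBorelTriple L 2 v).M × (cmDatum L 1 (Matrix.of fun i j : Fin 1 => if i.val + j.val + 1 = 1 then (1 : L) else 0)).Local v → ℂ,
      (∀ u ∈ F, cj u =
        finTau L v ((u.1 : ↥(unitaryGroupOfForm (conjLocal L (IsCMField.complexConj L) v) (cmLocalForm L 2 v))), u.2) μ * (κG * κ) / κH u) ∧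
      (∀ u ∈ F, cj u * κH u =
        finTau L v ((u.1 : ↥(unitaryGroupOfForm (conjLocal L (IsCMField.complexConj L) v) (cmLocalForm L 2 v))), u.2) μ * (κG * κ)) ∧
      (∀ u ∈ F, cj u * (A u * rH) =
        finTau L v ((u.1 : ↥(unitaryGroupOfForm (conjLocal L (IsCMField.complexConj L) v) (cmLocalForm L 2 v))), u.2) μ * (AG * rG)) :=
  exists_cj_both F (fun u => finTau L v ((u.1 : ↥(unitaryGroupOfForm (conjLocal L (IsCMField.complexConj L) v) (cmLocalForm L 2 v))), u.2) μ) κH A (κG * κ) AG rG rH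
    hκH hAH hAG

/-- **The `hτ`-to-representative rewrite packaged with the block**: whenever ★ HTAU gives `finTau L v γH μ = finTau L v (↑u.1, u.2) μ` at a stratum point lying in the coset of
`u ∈ F`, the TRANSFER identity reads `cj u · κ_H u = finTau L v γH μ · (κ_G κ)` at that point (the literal `hval`∕`hτ` pairing inside ★ `hc_of_cosets`). [cite: Rogawski1990,
§12.7 Lemma 12.7.3 (proof) p. 195] -/
theorem cj_mul_eq_finTau_of_eq (μ : HeckeCharacter L)
    (F : Finset (↥(cmBorelTriple L 2 v).M × (cmDatum L 1 (Matrix.of fun i j : Fin 1 => if i.val + j.val + 1 = 1 then (1 : L) else 0)).Local v))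
    (κG κ : ℂ)
    (κH cj : ↥(cmBorelTriple L 2 v).M × (cmDatum L 1 (Matrix.of fun i j : Fin 1 => if i.val + j.val + 1 = 1 then (1 : L) else 0)).Local v → ℂ)
    (hval : ∀ u ∈ F, cj u * κH u =
      finTau L v ((u.1 : ↥(unitaryGroupOfForm (conjLocal L (IsCMField.complexConj L) v) (cmLocalForm L 2 v))), u.2) μ * (κG * κ))
    (γH : (cmDatum L 2 (Matrix.of fun i j : Fin 2 => if i.val + j.val + 1 = 2 then (1 : L) else 0)).Local v ×
      (cmDatum L 1 (Matrix.of fun i j : Fin 1 => if i.val + j.val + 1 = 1 then (1 : L) else 0)).Local v)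
    {u : ↥(cmBorelTriple L 2 v).M × (cmDatum L 1 (Matrix.of fun i j : Fin 1 => if i.val + j.val + 1 = 1 then (1 : L) else 0)).Local v} (hu : u ∈ F)
    (hτ : finTau L v γH μ = finTau L v ((u.1 : ↥(unitaryGroupOfForm (conjLocal L (IsCMField.complexConj L) v) (cmLocalForm L 2 v))), u.2) μ) :
    cj u * κH u = finTau L v γH μ * (κG * κ) := by
  rw [hτ]; exact hval u hu

end CM

end Summit.HodgeConjecture.HodgeConjecture.Cruxes.H413.F0P3cStCharTSCjBlock

end
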